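import Summits.AtomisticToContinuum.HydrodynamicLimit.Theses.AntiMazurCoboundaries
import Summits.AtomisticToContinuum.HydrodynamicLimit.Theorems.AntiMazurCoboundariesKineticWindowGronwallPlusNode
import Summits.AtomisticToContinuum.HydrodynamicLimit.Theorems.AntiMazurCoboundariesHomogeneousInvariance

/-!
# Strategist gen-2 sketch (crux `KineticWindowGronwall`, stmt-AtomisticToContinuum-9282): the TRANSFER lens' one lemma with teeth —
# Rényi almost-invariance of local Gibbs laws over kinetic windows (candidate tool for content (iii) of the local node; NOT a stub of any line)
-/

noncomputable section

open MeasureTheory Set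
open scoped ENNReal
open Literature.MathematicalPhysics.KineticTheory Literature.Analysis.FluidPDE

namespace Summit.AtomisticToContinuum.HydrodynamicLimit.Cruxes.KineticWindowGronwall.StrategistG2

/-- The hard-sphere flow of `N+1` spheres at reduced density `σ` on `𝕋³`. -/
abbrev TFlow (σ : ℝ) (N : ℕ) : Type :=
  HardSphereFlow (Torus.geometry (Fin 3)) (hsDiameter σ N) (N + 1)

/-- **`LocalGibbsWindowRenyi` (candidate lemma, transfer of the solved sibling's "invariance ⇒ window structure" step to LOCAL references).**
For a temperature range `[θm, θM]` and a drift bound `U` there is an order `p > 1` (expected: any `p < θM/(θM − θm)`) such that for every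
continuous local Gibbs datum within the bounds, every `0 < σ ≤ 1/2`, every `ε > 0` and every `τ > 0`, eventually in `N`, for every flow and
every time `r` inside the kinetic window `[0, τ(N+1)^{-1/3}]`, the order-`p` Rényi integral of the time-`r` law against the initial local Gibbs
law is `≤ e^{ε(N+1)}`: local Gibbs laws are ALMOST INVARIANT over kinetic windows at the Rényi level (the global law is exactly invariant —
`HomogeneousInvariance`). Heuristic size of the log: `O((p−1)² N h² · poly(θM, U, ‖∇ log a‖, ‖∇θ‖, ‖∇u‖))`, `h = τ(N+1)^{-1/3}`, i.e. `O(N^{1/3})`.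
Proof obligations noted in the census: NO Jensen-in-time on the cubic streaming term `Σᵢ vᵢ·∇ₓ(λ·ζ)` (its window integral is the BOUNDED
oscillation `λ(x+hv) − λ(x)`, while `exp(h·cubic)` has infinite Maxwellian expectation); collision chains change `Σᵢ λ(xᵢ)·ζ(vᵢ)` only by
`O(d‖∇λ‖·|Δζ|)` per collision (momentum/energy conservation at common parameters). What it buys (Hölder): for measurable `G ≥ 0`,
`E_λ[G ∘ Φ_r] ≤ e^{ε(N+1)/p} (E_λ[G^q])^{1/q}`, `q = p/(p−1)` — the window clause `∃τ₀ ∀τ ≥ τ₀`, the subadditivity `τΛ_τ` and the Jensen-in-time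
static steps UNDER LOCAL GIBBS REFERENCES at an `O(1)` amplitude loss — content (iii) of the local node; it gives nothing on (i) locality / (ii)
density band. -/
def LocalGibbsWindowRenyi : Prop :=
  ∀ (θm θM U : ℝ), 0 < θm → θm ≤ θM → 0 ≤ U → ∃ p : ℝ, 1 < p ∧
    ∀ (a θ₀ : T3 → ℝ) (u₀ : T3 → V3), Continuous a → Continuous θ₀ → Continuous u₀ →
    (∀ x, 0 < a x) → (∀ x, θm ≤ θ₀ x) → (∀ x, θ₀ x ≤ θM) → (∀ x, ‖u₀ x‖ ≤ U) →
    ∀ σ : ℝ, 0 < σ → σ ≤ 1 / 2 → ∀ ε : ℝ, 0 < ε → ∀ τ : ℝ, 0 < τ → ∃ N₀ : ℕ, ∀ N : ℕ, N₀ ≤ N →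
    ∀ Φ : TFlow σ N, ∀ r ∈ Set.Icc (0 : ℝ) (τ * ((N : ℝ) + 1) ^ (-(1 / 3 : ℝ))),
      ∫⁻ z, ((Φ.lawAt (localGibbsLaw σ a u₀ θ₀ N Φ) r).rnDeriv (localGibbsLaw σ a u₀ θ₀ N Φ) z) ^ p
          ∂(localGibbsLaw σ a u₀ θ₀ N Φ) ≤
        ENNReal.ofReal (Real.exp (ε * ((N : ℝ) + 1)))

/-- **What the lemma buys (Hölder form), typed**: under `LocalGibbsWindowRenyi`, expectations of nonnegative functionals composed with the flow at
window times are controlled by their static `q`-moments under the SAME local Gibbs law, at cost `e^{ε(N+1)}` — the local substitute for the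
invariance of `G_N`. (Statement only; the Hölder step is `ENNReal.lintegral_mul_le_Lp_mul_Lq` on `dλ_r/dλ · G`.) -/
def LocalWindowHolder : Prop :=
  ∀ (θm θM U : ℝ), 0 < θm → θm ≤ θM → 0 ≤ U → ∃ q : ℝ, 1 < q ∧
    ∀ (a θ₀ : T3 → ℝ) (u₀ : T3 → V3), Continuous a → Continuous θ₀ → Continuous u₀ →
    (∀ x, 0 < a x) → (∀ x, θm ≤ θ₀ x) → (∀ x, θ₀ x ≤ θM) → (∀ x, ‖u₀ x‖ ≤ U) →
    ∀ σ : ℝ, 0 < σ → σ ≤ 1 / 2 → ∀ ε : ℝ, 0 < ε → ∀ τ : ℝ, 0 < τ → ∃ N₀ : ℕ, ∀ N : ℕ, N₀ ≤ N →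
    ∀ Φ : TFlow σ N, ∀ r ∈ Set.Icc (0 : ℝ) (τ * ((N : ℝ) + 1) ^ (-(1 / 3 : ℝ))),
    ∀ G : Config (N + 1) (Fin 3) T3 → ℝ≥0∞, Measurable G →
      ∫⁻ z, G (Φ.flow r z) ∂(localGibbsLaw σ a u₀ θ₀ N Φ) ≤
        ENNReal.ofReal (Real.exp (ε * ((N : ℝ) + 1))) *
          (∫⁻ z, G z ^ q ∂(localGibbsLaw σ a u₀ θ₀ N Φ)) ^ (1 / q)

/-- The global law is the `p`-trivial case: exactly invariant (landed `HomogeneousInvariance`), so every Rényi integral is `1`. Sanity that the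
frame is the right one: at constant profiles `lawAt` does not move the law. -/
example (σ c θc : ℝ) (uc : V3) (hσ : 0 < σ) (hc : 0 < c) (hθ : 0 < θc) (N : ℕ) (Φ : TFlow σ N) (t : ℝ) :
    Φ.lawAt (localGibbsLaw σ (fun _ => c) (fun _ => uc) (fun _ => θc) N Φ) t =
      localGibbsLaw σ (fun _ => c) (fun _ => uc) (fun _ => θc) N Φ :=
  Summit.AtomisticToContinuum.HydrodynamicLimit.Theorems.homogeneousInvariance_proof σ c θc uc hσ hc hθ N Φ t

end Summit.AtomisticToContinuum.HydrodynamicLimit.Cruxes.KineticWindowGronwall.StrategistG2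

end
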